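import Summits.AtomisticToContinuum.HydrodynamicLimit.Theorems.ImplosionDichotomyPolynomialCompressionLevel3DefsB
import Summits.AtomisticToContinuum.HydrodynamicLimit.Theorems.ImplosionDichotomyPolynomialCompressionReferenceJets
import Summits.AtomisticToContinuum.HydrodynamicLimit.Theorems.ImplosionDichotomyPolynomialCompressionShadowRegularity
import Summits.AtomisticToContinuum.HydrodynamicLimit.Theorems.ImplosionDichotomyPolynomialCompressionTorusJetCalculus

/-!
# Closing of stub 4, auxiliaries: initial level energies, sup smallness, packing extension

Helper file for the line `log-lipschitz-budget` of the crux `ImplosionDichotomy.PolynomialCompression`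
(stmt-AtomisticToContinuum-12587), stub `stub_logBudgetShadowing`, the CLOSE (continuous induction). Three inputs of
the bootstrap run: (i) at `t = 0` the velocity and temperature differences vanish and the density difference is
`O(σ³)` in `C⁴`, so `√E_k(0) ≤ σ³ · Cstat k · √(3ᵏ M_A/2)` (`k = 1, 2, 3`); (ii) the Sobolev sup bounds of
`lbClose_sup_bounds` give the unweighted magnitudes `l3m0 ≤ 5√(K_S m⁻¹ 6ℰ)`, `l3m1 ≤ 15√(K_S m⁻¹ 6ℰ)`; (iii) a packing
bound `ρσ³ ≤ η_s` on `[0, t]` extends to `ρσ³ < 2η_s` on `[0, t')` for some `t' ∈ (t, T]` (continuity of the sup norm in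
time, `shadow_sup_continuous`); (iv) the pure-real cores `pcClose_ratio_real`, `pcClose_interp_real` of the weight-ratio
bound and of the interpolation closure of the improvement step `pcClose_step`.
-/

noncomputable section

namespace Summit.AtomisticToContinuum.HydrodynamicLimit.Theorems

open Set MeasureTheory Filter Topology
open Literature.MathematicalPhysics.KineticTheory Literature.Analysis.FunctionSpaces

/-- The difference of the velocities vanishes identically at `t = 0` when the data agree, and so do its
first three spatial derivatives; the same for the temperatures. [folklore] -/
theorem pcClose_data_derivs_zero {ρ θ ρ₁ θ₁ : ℝ → T3 → ℝ} {u u₁ : ℝ → T3 → V3}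
    (hu0 : u 0 = u₁ 0) (hθ0 : θ 0 = θ₁ 0) (x : T3) (a b c : Fin 3) :
    Torus.partialDeriv a (fun y => u 0 y - u₁ 0 y) x = 0 ∧
      Torus.partialDeriv b (Torus.partialDeriv a (fun y => u 0 y - u₁ 0 y)) x = 0 ∧
      Torus.partialDeriv c (Torus.partialDeriv b (Torus.partialDeriv a (fun y => u 0 y - u₁ 0 y))) x = 0 ∧
      Torus.partialDeriv a (fun y => θ 0 y - θ₁ 0 y) x = 0 ∧
      Torus.partialDeriv b (Torus.partialDeriv a (fun y => θ 0 y - θ₁ 0 y)) x = 0 ∧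
      Torus.partialDeriv c (Torus.partialDeriv b (Torus.partialDeriv a (fun y => θ 0 y - θ₁ 0 y))) x = 0 ∧
      (ρ 0 x - ρ₁ 0 x) - (ρ 0 x - ρ₁ 0 x) = 0 := by
  have hu : (fun y => u 0 y - u₁ 0 y) = fun _ => (0 : V3) := by funext y; rw [hu0, sub_self]
  have hθ : (fun y => θ 0 y - θ₁ 0 y) = fun _ => (0 : ℝ) := by funext y; rw [hθ0, sub_self]
  have c1 : ∀ (i : Fin 3), Torus.partialDeriv i (fun _ : T3 => (0 : V3)) = fun _ => 0 := fun i => by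
    funext y; simp [Torus.partialDeriv, Torus.lineDeriv]
  have c2 : ∀ (i : Fin 3), Torus.partialDeriv i (fun _ : T3 => (0 : ℝ)) = fun _ => 0 := fun i => by
    funext y; simp [Torus.partialDeriv, Torus.lineDeriv]
  refine ⟨?_, ?_, ?_, ?_, ?_, ?_, sub_self _⟩
  · rw [hu, c1]
  · rw [hu, c1, c1]
  · rw [hu, c1, c1, c1]
  · rw [hθ, c2]
  · rw [hθ, c2, c2]
  · rw [hθ, c2, c2, c2]

/-- **Initial smallness of the level energies `E₁, E₂, E₃`.** If `u(0) = u₁(0)`, `θ(0) = θ₁(0)`, the weight `A(0, ·)`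
lies in `[0, M_A]`, and the density difference at `t = 0` has lift derivatives of orders `≤ 4` bounded by
`Cstat n σ³`, then `√E₁(0) ≤ σ³ Cstat 1 √(3M_A/2)`, `√E₂(0) ≤ σ³ Cstat 2 √(9M_A/2)`, `√E₃(0) ≤ σ³ Cstat 3 √(27M_A/2)`.
[folklore] -/
theorem pcClose_init_energies :
    ∀ {σ σ₁ T : ℝ} {ρ θ ρ₁ θ₁ : ℝ → T3 → ℝ} {u u₁ : ℝ → T3 → V3} {ζ : ℝ → ℝ} {MA : ℝ} {Cstat : ℕ → ℝ},
      IsHardSphereEulerSolution σ T ρ u θ → IsHardSphereEulerSolution σ₁ T ρ₁ u₁ θ₁ → 0 < T →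
      u 0 = u₁ 0 → θ 0 = θ₁ 0 → 0 ≤ σ → (∀ n, 0 ≤ Cstat n) →
      (∀ x, 0 ≤ shadowWeightA ζ ρ θ 0 x ∧ shadowWeightA ζ ρ θ 0 x ≤ MA) →
      (∀ n : ℕ, n ≤ 6 → ∀ y : EuclideanSpace ℝ (Fin 3),
        ‖iteratedFDeriv ℝ n (Torus.lift (fun x => ρ 0 x - ρ₁ 0 x)) y‖ ≤ Cstat n * σ ^ 3) →
      Real.sqrt (shadowE1 ζ ρ θ u ρ₁ θ₁ u₁ 0) ≤ σ ^ 3 * (Cstat 1 * Real.sqrt (3 * MA / 2)) ∧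
        Real.sqrt (shadowE2 ζ ρ θ u ρ₁ θ₁ u₁ 0) ≤ σ ^ 3 * (Cstat 2 * Real.sqrt (9 * MA / 2)) ∧
        Real.sqrt (shadowE3 ζ ρ θ u ρ₁ θ₁ u₁ 0) ≤ σ ^ 3 * (Cstat 3 * Real.sqrt (27 * MA / 2)) := by
  intro σ σ₁ T ρ θ ρ₁ θ₁ u u₁ ζ MA Cstat hE hE₁ hT hu0 hθ0 hσ hCs hA hstat
  have h0 : (0 : ℝ) ∈ Ico 0 T := ⟨le_rfl, hT⟩
  have hsm : Torus.IsSmooth (fun x => ρ 0 x - ρ₁ 0 x) :=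
    (hE.smooth_density.isSmooth_slice h0).sub (hE₁.smooth_density.isSmooth_slice h0)
  have hMA : 0 ≤ MA := by obtain ⟨h1, h2⟩ := hA (Classical.arbitrary T3); exact h1.trans h2
  have hD := fun x (i j k l : Fin 3) =>
    torus_partialDeriv_iter_le_of_lift_bounds hsm (M := fun n => Cstat n * σ ^ 3)
      (fun n hn y => hstat n (by omega) y) x i j k l
  -- pointwise bounds of the three integrands
  have hZ := fun x (a b c : Fin 3) => pcClose_data_derivs_zero (ρ := ρ) (ρ₁ := ρ₁) hu0 hθ0 x a b c
  have key : ∀ (k : ℕ) (d : ℝ) (x : T3), |d| ≤ Cstat k * σ ^ 3 →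
      1 / 2 * (shadowWeightA ζ ρ θ 0 x * d ^ 2 + ρ 0 x * ‖(0 : V3)‖ ^ 2 + shadowWeightB ρ θ 0 x * (0 : ℝ) ^ 2) ≤
        1 / 2 * (MA * (Cstat k * σ ^ 3) ^ 2) := by
    intro k d x hd
    have hd2 : d ^ 2 ≤ (Cstat k * σ ^ 3) ^ 2 := sq_le_sq' (abs_le.1 hd).1 (abs_le.1 hd).2
    rw [norm_zero]
    have h := mul_le_mul (hA x).2 hd2 (sq_nonneg _) hMA
    nlinarith [(hA x).1]
  -- level 1
  have p1 : ∀ x, 0 ≤ ∑ l : Fin 3, 1 / 2 * (shadowWeightA ζ ρ θ 0 x *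
      (Torus.partialDeriv l (fun y => ρ 0 y - ρ₁ 0 y) x) ^ 2 +
      ρ 0 x * ‖Torus.partialDeriv l (fun y => u 0 y - u₁ 0 y) x‖ ^ 2 +
      shadowWeightB ρ θ 0 x * (Torus.partialDeriv l (fun y => θ 0 y - θ₁ 0 y) x) ^ 2) ∧
      ∑ l : Fin 3, 1 / 2 * (shadowWeightA ζ ρ θ 0 x *
      (Torus.partialDeriv l (fun y => ρ 0 y - ρ₁ 0 y) x) ^ 2 +
      ρ 0 x * ‖Torus.partialDeriv l (fun y => u 0 y - u₁ 0 y) x‖ ^ 2 +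
      shadowWeightB ρ θ 0 x * (Torus.partialDeriv l (fun y => θ 0 y - θ₁ 0 y) x) ^ 2) ≤
      3 * (1 / 2 * (MA * (Cstat 1 * σ ^ 3) ^ 2)) := by
    intro x
    have hterm : ∀ l : Fin 3, 0 ≤ 1 / 2 * (shadowWeightA ζ ρ θ 0 x *
        (Torus.partialDeriv l (fun y => ρ 0 y - ρ₁ 0 y) x) ^ 2 +
        ρ 0 x * ‖Torus.partialDeriv l (fun y => u 0 y - u₁ 0 y) x‖ ^ 2 +
        shadowWeightB ρ θ 0 x * (Torus.partialDeriv l (fun y => θ 0 y - θ₁ 0 y) x) ^ 2) ∧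
        1 / 2 * (shadowWeightA ζ ρ θ 0 x *
        (Torus.partialDeriv l (fun y => ρ 0 y - ρ₁ 0 y) x) ^ 2 +
        ρ 0 x * ‖Torus.partialDeriv l (fun y => u 0 y - u₁ 0 y) x‖ ^ 2 +
        shadowWeightB ρ θ 0 x * (Torus.partialDeriv l (fun y => θ 0 y - θ₁ 0 y) x) ^ 2) ≤
        1 / 2 * (MA * (Cstat 1 * σ ^ 3) ^ 2) := by
      intro l
      obtain ⟨z1, -, -, z4, -, -, -⟩ := hZ x l l l
      rw [z1, z4]
      have hsq := sq_nonneg (Torus.partialDeriv l (fun y => ρ 0 y - ρ₁ 0 y) x)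
      exact ⟨by rw [norm_zero]; nlinarith [(hA x).1, hsq], key 1 _ x (hD x l l l l).1⟩
    refine ⟨Finset.sum_nonneg fun l _ => (hterm l).1, ?_⟩
    calc _ ≤ ∑ _l : Fin 3, 1 / 2 * (MA * (Cstat 1 * σ ^ 3) ^ 2) := Finset.sum_le_sum fun l _ => (hterm l).2
      _ = _ := by simp
  -- level 2
  have p2 : ∀ x, 0 ≤ ∑ i : Fin 3, ∑ l : Fin 3, 1 / 2 * (shadowWeightA ζ ρ θ 0 x *
      (Torus.partialDeriv i (Torus.partialDeriv l (fun y => ρ 0 y - ρ₁ 0 y)) x) ^ 2 +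
      ρ 0 x * ‖Torus.partialDeriv i (Torus.partialDeriv l (fun y => u 0 y - u₁ 0 y)) x‖ ^ 2 +
      shadowWeightB ρ θ 0 x * (Torus.partialDeriv i (Torus.partialDeriv l (fun y => θ 0 y - θ₁ 0 y)) x) ^ 2) ∧
      ∑ i : Fin 3, ∑ l : Fin 3, 1 / 2 * (shadowWeightA ζ ρ θ 0 x *
      (Torus.partialDeriv i (Torus.partialDeriv l (fun y => ρ 0 y - ρ₁ 0 y)) x) ^ 2 +
      ρ 0 x * ‖Torus.partialDeriv i (Torus.partialDeriv l (fun y => u 0 y - u₁ 0 y)) x‖ ^ 2 +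
      shadowWeightB ρ θ 0 x * (Torus.partialDeriv i (Torus.partialDeriv l (fun y => θ 0 y - θ₁ 0 y)) x) ^ 2) ≤
      9 * (1 / 2 * (MA * (Cstat 2 * σ ^ 3) ^ 2)) := by
    intro x
    have hterm : ∀ i l : Fin 3, 0 ≤ 1 / 2 * (shadowWeightA ζ ρ θ 0 x *
        (Torus.partialDeriv i (Torus.partialDeriv l (fun y => ρ 0 y - ρ₁ 0 y)) x) ^ 2 +
        ρ 0 x * ‖Torus.partialDeriv i (Torus.partialDeriv l (fun y => u 0 y - u₁ 0 y)) x‖ ^ 2 +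
        shadowWeightB ρ θ 0 x * (Torus.partialDeriv i (Torus.partialDeriv l (fun y => θ 0 y - θ₁ 0 y)) x) ^ 2) ∧
        1 / 2 * (shadowWeightA ζ ρ θ 0 x *
        (Torus.partialDeriv i (Torus.partialDeriv l (fun y => ρ 0 y - ρ₁ 0 y)) x) ^ 2 +
        ρ 0 x * ‖Torus.partialDeriv i (Torus.partialDeriv l (fun y => u 0 y - u₁ 0 y)) x‖ ^ 2 +
        shadowWeightB ρ θ 0 x * (Torus.partialDeriv i (Torus.partialDeriv l (fun y => θ 0 y - θ₁ 0 y)) x) ^ 2) ≤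
        1 / 2 * (MA * (Cstat 2 * σ ^ 3) ^ 2) := by
      intro i l
      obtain ⟨-, z2, -, -, z5, -, -⟩ := hZ x l i i
      rw [z2, z5]
      have hsq := sq_nonneg (Torus.partialDeriv i (Torus.partialDeriv l (fun y => ρ 0 y - ρ₁ 0 y)) x)
      exact ⟨by rw [norm_zero]; nlinarith [(hA x).1, hsq], key 2 _ x (hD x i l l l).2.1⟩
    refine ⟨Finset.sum_nonneg fun i _ => Finset.sum_nonneg fun l _ => (hterm i l).1, ?_⟩
    calc _ ≤ ∑ _i : Fin 3, ∑ _l : Fin 3, 1 / 2 * (MA * (Cstat 2 * σ ^ 3) ^ 2) :=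
          Finset.sum_le_sum fun i _ => Finset.sum_le_sum fun l _ => (hterm i l).2
      _ = _ := by simp; ring
  -- level 3
  have p3 : ∀ x, 0 ≤ ∑ j : Fin 3, ∑ i : Fin 3, ∑ l : Fin 3, 1 / 2 * (shadowWeightA ζ ρ θ 0 x *
      (Torus.partialDeriv j (Torus.partialDeriv i (Torus.partialDeriv l (fun y => ρ 0 y - ρ₁ 0 y))) x) ^ 2 +
      ρ 0 x * ‖Torus.partialDeriv j (Torus.partialDeriv i (Torus.partialDeriv l (fun y => u 0 y - u₁ 0 y))) x‖ ^ 2 +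
      shadowWeightB ρ θ 0 x *
        (Torus.partialDeriv j (Torus.partialDeriv i (Torus.partialDeriv l (fun y => θ 0 y - θ₁ 0 y))) x) ^ 2) ∧
      ∑ j : Fin 3, ∑ i : Fin 3, ∑ l : Fin 3, 1 / 2 * (shadowWeightA ζ ρ θ 0 x *
      (Torus.partialDeriv j (Torus.partialDeriv i (Torus.partialDeriv l (fun y => ρ 0 y - ρ₁ 0 y))) x) ^ 2 +
      ρ 0 x * ‖Torus.partialDeriv j (Torus.partialDeriv i (Torus.partialDeriv l (fun y => u 0 y - u₁ 0 y))) x‖ ^ 2 +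
      shadowWeightB ρ θ 0 x *
        (Torus.partialDeriv j (Torus.partialDeriv i (Torus.partialDeriv l (fun y => θ 0 y - θ₁ 0 y))) x) ^ 2) ≤
      27 * (1 / 2 * (MA * (Cstat 3 * σ ^ 3) ^ 2)) := by
    intro x
    have hterm : ∀ j i l : Fin 3, 0 ≤ 1 / 2 * (shadowWeightA ζ ρ θ 0 x *
        (Torus.partialDeriv j (Torus.partialDeriv i (Torus.partialDeriv l (fun y => ρ 0 y - ρ₁ 0 y))) x) ^ 2 +
        ρ 0 x * ‖Torus.partialDeriv j (Torus.partialDeriv i (Torus.partialDeriv l (fun y => u 0 y - u₁ 0 y))) x‖ ^ 2 +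
        shadowWeightB ρ θ 0 x *
          (Torus.partialDeriv j (Torus.partialDeriv i (Torus.partialDeriv l (fun y => θ 0 y - θ₁ 0 y))) x) ^ 2) ∧
        1 / 2 * (shadowWeightA ζ ρ θ 0 x *
        (Torus.partialDeriv j (Torus.partialDeriv i (Torus.partialDeriv l (fun y => ρ 0 y - ρ₁ 0 y))) x) ^ 2 +
        ρ 0 x * ‖Torus.partialDeriv j (Torus.partialDeriv i (Torus.partialDeriv l (fun y => u 0 y - u₁ 0 y))) x‖ ^ 2 +
        shadowWeightB ρ θ 0 x *
          (Torus.partialDeriv j (Torus.partialDeriv i (Torus.partialDeriv l (fun y => θ 0 y - θ₁ 0 y))) x) ^ 2) ≤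
        1 / 2 * (MA * (Cstat 3 * σ ^ 3) ^ 2) := by
      intro j i l
      obtain ⟨-, -, z3, -, -, z6, -⟩ := hZ x l i j
      rw [z3, z6]
      have hsq := sq_nonneg
        (Torus.partialDeriv j (Torus.partialDeriv i (Torus.partialDeriv l (fun y => ρ 0 y - ρ₁ 0 y))) x)
      exact ⟨by rw [norm_zero]; nlinarith [(hA x).1, hsq], key 3 _ x (hD x j i l l).2.2.1⟩
    refine ⟨Finset.sum_nonneg fun j _ => Finset.sum_nonneg fun i _ => Finset.sum_nonneg fun l _ => (hterm j i l).1, ?_⟩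
    calc _ ≤ ∑ _j : Fin 3, ∑ _i : Fin 3, ∑ _l : Fin 3, 1 / 2 * (MA * (Cstat 3 * σ ^ 3) ^ 2) :=
          Finset.sum_le_sum fun j _ => Finset.sum_le_sum fun i _ => Finset.sum_le_sum fun l _ => (hterm j i l).2
      _ = _ := by simp; ring
  -- integrate over the probability space and take roots
  have fin : ∀ (E c q : ℝ) (f : T3 → ℝ), E = ∫ x, f x → (∀ x, 0 ≤ f x ∧ f x ≤ c) → 0 ≤ q → c = q ^ 2 →
      Real.sqrt E ≤ q := by
    intro E c q f hEf hf hq hcq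
    have h := norm_integral_le_of_norm_le_const (μ := (volume : Measure T3)) (f := f) (C := c)
      (Eventually.of_forall fun x => by rw [Real.norm_of_nonneg (hf x).1]; exact (hf x).2)
    rw [probReal_univ, mul_one, Real.norm_eq_abs] at h
    rw [Real.sqrt_le_left hq, hEf, ← hcq]
    exact (le_abs_self _).trans h
  have hs3 : Real.sqrt (3 * MA / 2) ^ 2 = 3 * MA / 2 := Real.sq_sqrt (by positivity)
  have hs9 : Real.sqrt (9 * MA / 2) ^ 2 = 9 * MA / 2 := Real.sq_sqrt (by positivity)
  have hs27 : Real.sqrt (27 * MA / 2) ^ 2 = 27 * MA / 2 := Real.sq_sqrt (by positivity)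
  have hC1 := hCs 1; have hC2 := hCs 2; have hC3 := hCs 3
  refine ⟨fin _ _ _ _ rfl p1 (by positivity) ?_, fin _ _ _ _ rfl p2 (by positivity) ?_,
    fin _ _ _ _ rfl p3 (by positivity) ?_⟩
  · linear_combination (-(σ ^ 3) ^ 2 * Cstat 1 ^ 2) * hs3
  · linear_combination (-(σ ^ 3) ^ 2 * Cstat 2 ^ 2) * hs9
  · linear_combination (-(σ ^ 3) ^ 2 * Cstat 3 ^ 2) * hs27

/-- **Unweighted sup smallness from the Sobolev bounds.** The per-point conclusion of `lbClose_sup_bounds`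
(squares of `δρ, δu, δθ` and of their first derivatives bounded by `K_S m_w⁻¹ (6ℰ)`) gives
`l3m0 ≤ 5 √(K_S m⁻¹ 6ℰ)` and `l3m1 ≤ 15 √(K_S m⁻¹ 6ℰ)` for any common lower bound `0 < m ≤ m_A, m_ρ, m_B`.
[folklore] -/
theorem pcClose_sup_small :
    ∀ {ρ θ ρ₁ θ₁ : ℝ → T3 → ℝ} {u u₁ : ℝ → T3 → V3} {s : ℝ} {x : T3} {KS mA mρ mB m ℰ : ℝ},
      Torus.IsSmooth (fun y => u s y - u₁ s y) → 0 < m → m ≤ mA → m ≤ mρ → m ≤ mB → 0 ≤ KS → 0 ≤ ℰ →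
      ((ρ s x - ρ₁ s x) ^ 2 ≤ KS * mA⁻¹ * (6 * ℰ) ∧ ‖u s x - u₁ s x‖ ^ 2 ≤ KS * mρ⁻¹ * (6 * ℰ) ∧
        (θ s x - θ₁ s x) ^ 2 ≤ KS * mB⁻¹ * (6 * ℰ) ∧
        ∀ l : Fin 3, (Torus.partialDeriv l (fun y => ρ s y - ρ₁ s y) x) ^ 2 ≤ KS * mA⁻¹ * (6 * ℰ) ∧
          ‖Torus.partialDeriv l (fun y => u s y - u₁ s y) x‖ ^ 2 ≤ KS * mρ⁻¹ * (6 * ℰ) ∧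
          (Torus.partialDeriv l (fun y => θ s y - θ₁ s y) x) ^ 2 ≤ KS * mB⁻¹ * (6 * ℰ)) →
      l3m0 ρ θ ρ₁ θ₁ u u₁ s x ≤ 5 * Real.sqrt (KS * m⁻¹ * (6 * ℰ)) ∧
        l3m1 ρ θ ρ₁ θ₁ u u₁ s x ≤ 15 * Real.sqrt (KS * m⁻¹ * (6 * ℰ)) := by
  intro ρ θ ρ₁ θ₁ u u₁ s x KS mA mρ mB m ℰ hsm hm hmA hmρ hmB hKS hℰ h
  obtain ⟨h1, h2, h3, hd⟩ := h
  set G : ℝ := Real.sqrt (KS * m⁻¹ * (6 * ℰ)) with hG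
  -- a square bound with any weight floor `≥ m` gives the bound `G`
  have up : ∀ {a w : ℝ}, m ≤ w → a ^ 2 ≤ KS * w⁻¹ * (6 * ℰ) → |a| ≤ G := by
    intro a w hw ha
    have hw0 : 0 < w := hm.trans_le hw
    have hmono : KS * w⁻¹ * (6 * ℰ) ≤ KS * m⁻¹ * (6 * ℰ) :=
      mul_le_mul_of_nonneg_right (mul_le_mul_of_nonneg_left ((inv_le_inv₀ hw0 hm).2 hw) hKS) (by positivity)
    rw [← Real.sqrt_sq_eq_abs]
    exact Real.sqrt_le_sqrt (ha.trans hmono)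
  have upn : ∀ {v : V3} {w : ℝ}, m ≤ w → ‖v‖ ^ 2 ≤ KS * w⁻¹ * (6 * ℰ) → ‖v‖ ≤ G := by
    intro v w hw hv
    have := up (a := ‖v‖) hw hv
    rwa [abs_norm] at this
  have hcoord : ∀ (v : V3) (i : Fin 3), |v i| ≤ ‖v‖ := fun v i => by
    rw [← Real.norm_eq_abs]; exact PiLp.norm_apply_le v i
  -- derivatives of the coordinates of `δu` are coordinates of the derivative
  have hdc : ∀ (i a : Fin 3), Torus.partialDeriv a (fun y => u s y i - u₁ s y i) x =
      Torus.partialDeriv a (fun y => u s y - u₁ s y) x i := by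
    intro i a
    have e : (fun y => u s y i - u₁ s y i) = fun y => (fun y' => u s y' - u₁ s y') y i := by
      funext y; simp only [PiLp.sub_apply]
    rw [e]
    exact torusJet_apply_coord_deriv1 hsm i a x
  constructor
  · unfold l3m0
    have a1 := up hmA h1
    have a3 := up hmB h3
    have a2 : ∀ i, |u s x i - u₁ s x i| ≤ G := fun i => by
      have e : u s x i - u₁ s x i = (u s x - u₁ s x) i := by simp only [PiLp.sub_apply]
      rw [e]; exact (hcoord _ i).trans (upn hmρ h2)
    have hs : ∑ i : Fin 3, |u s x i - u₁ s x i| ≤ 3 * G := by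
      calc ∑ i : Fin 3, |u s x i - u₁ s x i| ≤ ∑ _i : Fin 3, G := Finset.sum_le_sum fun i _ => a2 i
        _ = 3 * G := by simp
    linarith
  · unfold l3m1 Torus.dsize₁
    have b1 : ∑ a : Fin 3, |Torus.partialDeriv a (fun y => ρ s y - ρ₁ s y) x| ≤ 3 * G := by
      calc _ ≤ ∑ _a : Fin 3, G := Finset.sum_le_sum fun a _ => up hmA (hd a).1
        _ = 3 * G := by simp
    have b3 : ∑ a : Fin 3, |Torus.partialDeriv a (fun y => θ s y - θ₁ s y) x| ≤ 3 * G := by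
      calc _ ≤ ∑ _a : Fin 3, G := Finset.sum_le_sum fun a _ => up hmB (hd a).2.2
        _ = 3 * G := by simp
    have b2 : ∑ i : Fin 3, ∑ a : Fin 3, |Torus.partialDeriv a (fun y => u s y i - u₁ s y i) x| ≤ 9 * G := by
      calc _ ≤ ∑ _i : Fin 3, ∑ _a : Fin 3, G := Finset.sum_le_sum fun i _ => Finset.sum_le_sum fun a _ => by
              rw [hdc i a]; exact (hcoord _ i).trans (upn hmρ (hd a).2.1)
        _ = 9 * G := by simp; ring
    linarith

/-- **Packing extension.** A packing bound `ρσ³ ≤ η_s` on `[0, t]` extends to `ρσ³ < 2η_s` on `[0, t')` for some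
`t' ∈ (t, T]` (continuity in time of the sup norm of `ρσ³`, `shadow_sup_continuous`). [folklore] -/
theorem pcClose_extend :
    ∀ {σ T t ηs : ℝ} {ρ θ : ℝ → T3 → ℝ} {u : ℝ → T3 → V3}, IsHardSphereEulerSolution σ T ρ u θ → 0 ≤ σ →
      t ∈ Ico 0 T → 0 < ηs → (∀ s ∈ Icc 0 t, ∀ x, ρ s x * σ ^ 3 ≤ ηs) →
      ∃ t' : ℝ, t < t' ∧ t' ≤ T ∧ ∀ s ∈ Ico 0 t', ∀ x, ρ s x * σ ^ 3 < 2 * ηs := by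
  intro σ T t ηs ρ θ u hE hσ ht hηs hpack
  have hsm : Torus.IsSmoothSpaceTimeOn (Ico 0 T) (fun s x => σ ^ 3 * ρ s x) :=
    isSmoothSpaceTimeOn_const_mul hE.smooth_density (σ ^ 3)
  obtain ⟨hcont, hdom, hle⟩ := shadow_sup_continuous hsm
  set g : ℝ → ℝ := fun s => (eSupNorm (fun x => σ ^ 3 * ρ s x)).toReal with hg
  have hgt : g t ≤ ηs := hle t ηs hηs.le fun x => by
    rw [abs_of_nonneg (by have := hE.density_pos t ht x; positivity), mul_comm]; exact hpack t ⟨ht.1, le_rfl⟩ x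
  have hcw : ContinuousWithinAt g (Ico 0 T) t := hcont t ht
  rw [Metric.continuousWithinAt_iff] at hcw
  obtain ⟨δ, hδ, hδ'⟩ := hcw ηs hηs
  refine ⟨min T (t + δ), lt_min ht.2 (by linarith), min_le_left _ _, fun s hs x => ?_⟩
  by_cases hst : s ≤ t
  · have := hpack s ⟨hs.1, hst⟩ x; linarith
  · push Not at hst
    have hsT : s ∈ Ico 0 T := ⟨hs.1, hs.2.trans_le (min_le_left _ _)⟩
    have hdist : dist s t < δ := by
      rw [Real.dist_eq, abs_of_pos (by linarith)]; linarith [hs.2.trans_le (min_le_right _ _)]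
    have h1 := hδ' hsT hdist
    rw [Real.dist_eq] at h1
    have h2 : g s < 2 * ηs := by linarith [(abs_lt.1 h1).2]
    have h3 := hdom s hsT x
    rw [abs_of_nonneg (by have := hE.density_pos s hsT x; positivity)] at h3
    linarith

/-- Pure-real core of the weight-ratio bound in the improvement step: the floors `mK/Ye³ ≤ m`, the
ceilings `M ≤ MK·Ye³` and `MK/mK ≤ W` give `M/m ≤ W·B` once `Ye⁶ ≤ B`. [folklore] -/
theorem pcClose_ratio_real {m M mK MK Ye W B : ℝ} (hmK : 0 < mK) (hYe : 1 ≤ Ye)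
    (hMK : 0 ≤ MK) (hmfl : mK / Ye ^ 3 ≤ m) (hMce : M ≤ MK * Ye ^ 3) (hW : MK / mK ≤ W)
    (hW0 : 0 ≤ W) (hB : Ye ^ 6 ≤ B) : M / m ≤ W * B := by
  have hYe0 : 0 < Ye := by linarith
  have h1 : M / m ≤ (MK * Ye ^ 3) / (mK / Ye ^ 3) :=
    div_le_div₀ (by positivity) hMce (by positivity) hmfl
  have h2 : (MK * Ye ^ 3) / (mK / Ye ^ 3) = (MK / mK) * Ye ^ 6 := by
    rw [div_div_eq_mul_div, div_mul_eq_mul_div, div_eq_div_iff hmK.ne' hmK.ne']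
    ring
  calc M / m ≤ (MK / mK) * Ye ^ 6 := h1.trans_eq h2
    _ ≤ W * Ye ^ 6 := mul_le_mul_of_nonneg_right hW (by positivity)
    _ ≤ W * B := mul_le_mul_of_nonneg_left hB hW0

/-- Pure-real core of the interpolation closure in the improvement step: with the weight ratio
`ratio ≤ W X^pw`, the interpolation inequalities `E₁ ≤ √3·ratio·√E₀√E₂`, `E₂ ≤ √3·ratio·√E₁√E₃`, the
strong `E₀, E₃` bounds and the weak `E₁` bound, the choice `√3 W Q₀Q₂ ≤ Q₁²`, `2√3 W Q₁Q₃ ≤ Q₂²`,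
`pw + b₀ + b₂ ≤ 2b₁`, `pw + b₁ + b₃ ≤ 2b₂` returns the strong `E₁, E₂` bounds. [folklore] -/
theorem pcClose_interp_real {E0 E1 E2 E3 X W pw σ3 Q₀ Q₁ Q₂ Q₃ b₀ b₁ b₂ b₃ ratio : ℝ}
    (hX : 1 ≤ X) (hσ3 : 0 ≤ σ3) (hQ₁ : 0 ≤ Q₁) (hQ₂ : 0 ≤ Q₂)
    (hW0 : 0 ≤ W) (hr0 : 0 ≤ ratio) (hratio : ratio ≤ W * X ^ pw)
    (iE1 : E1 ≤ Real.sqrt 3 * ratio * Real.sqrt E0 * Real.sqrt E2)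
    (iE2 : E2 ≤ Real.sqrt 3 * ratio * Real.sqrt E1 * Real.sqrt E3)
    (e0 : Real.sqrt E0 ≤ σ3 * Q₀ * X ^ b₀) (e1w : Real.sqrt E1 ≤ 2 * (σ3 * Q₁ * X ^ b₁))
    (sE3 : Real.sqrt E3 ≤ σ3 * Q₃ * X ^ b₃)
    (hI12 : Real.sqrt 3 * W * Q₀ * Q₂ ≤ Q₁ ^ 2) (hI23 : 2 * Real.sqrt 3 * W * Q₁ * Q₃ ≤ Q₂ ^ 2)
    (hbI1 : pw + b₀ + b₂ ≤ 2 * b₁) (hbI2 : pw + b₁ + b₃ ≤ 2 * b₂) :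
    Real.sqrt E1 ≤ σ3 * Q₁ * X ^ b₁ ∧ Real.sqrt E2 ≤ σ3 * Q₂ * X ^ b₂ := by
  have hX0 : 0 < X := by linarith
  have hXb : ∀ {a b : ℝ}, a ≤ b → X ^ a ≤ X ^ b := fun hab => Real.rpow_le_rpow_of_exponent_le hX hab
  have hXpos : ∀ a : ℝ, 0 < X ^ a := fun a => Real.rpow_pos_of_pos hX0 a
  have hXadd : ∀ a b : ℝ, X ^ a * X ^ b = X ^ (a + b) := fun a b => (Real.rpow_add hX0 a b).symm
  have hs3 : 0 ≤ Real.sqrt 3 := Real.sqrt_nonneg 3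
  have hratW : Real.sqrt 3 * ratio ≤ Real.sqrt 3 * (W * X ^ pw) := mul_le_mul_of_nonneg_left hratio hs3
  have hrat0 : 0 ≤ Real.sqrt 3 * ratio := mul_nonneg hs3 hr0
  have hQ₃' : 0 ≤ σ3 * Q₃ * X ^ b₃ := (Real.sqrt_nonneg _).trans sE3
  have hQ₀' : 0 ≤ σ3 * Q₀ * X ^ b₀ := (Real.sqrt_nonneg _).trans e0
  have hWX : 0 ≤ W * X ^ pw := mul_nonneg hW0 (hXpos _).le
  -- the strong `E₂` bound
  have sE2 : Real.sqrt E2 ≤ σ3 * Q₂ * X ^ b₂ := by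
    have h1 : E2 ≤ Real.sqrt 3 * (W * X ^ pw) * (2 * (σ3 * Q₁ * X ^ b₁)) * (σ3 * Q₃ * X ^ b₃) :=
      iE2.trans (mul_le_mul (mul_le_mul hratW e1w (Real.sqrt_nonneg _) (hrat0.trans hratW)) sE3
        (Real.sqrt_nonneg _) (by positivity))
    have e : Real.sqrt 3 * (W * X ^ pw) * (2 * (σ3 * Q₁ * X ^ b₁)) * (σ3 * Q₃ * X ^ b₃) =
        (2 * Real.sqrt 3 * W * Q₁ * Q₃) * σ3 ^ 2 * (X ^ pw * X ^ b₁ * X ^ b₃) := by ring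
    have e' : (σ3 * Q₂ * X ^ b₂) ^ 2 = Q₂ ^ 2 * σ3 ^ 2 * (X ^ b₂ * X ^ b₂) := by ring
    have hx : X ^ pw * X ^ b₁ * X ^ b₃ ≤ X ^ b₂ * X ^ b₂ := by
      rw [hXadd, hXadd, hXadd]
      exact hXb (by linarith)
    have h2 : (2 * Real.sqrt 3 * W * Q₁ * Q₃) * σ3 ^ 2 * (X ^ pw * X ^ b₁ * X ^ b₃) ≤
        Q₂ ^ 2 * σ3 ^ 2 * (X ^ b₂ * X ^ b₂) :=
      mul_le_mul (mul_le_mul_of_nonneg_right hI23 (by positivity)) hx (by positivity) (by positivity)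
    refine Real.sqrt_le_iff.2 ⟨by positivity, ?_⟩
    rw [e']
    exact h1.trans (e.le.trans h2)
  -- the strong `E₁` bound
  have sE1 : Real.sqrt E1 ≤ σ3 * Q₁ * X ^ b₁ := by
    have h1 : E1 ≤ Real.sqrt 3 * (W * X ^ pw) * (σ3 * Q₀ * X ^ b₀) * (σ3 * Q₂ * X ^ b₂) :=
      iE1.trans (mul_le_mul (mul_le_mul hratW e0 (Real.sqrt_nonneg _) (hrat0.trans hratW)) sE2
        (Real.sqrt_nonneg _) (by positivity))
    have e : Real.sqrt 3 * (W * X ^ pw) * (σ3 * Q₀ * X ^ b₀) * (σ3 * Q₂ * X ^ b₂) =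
        (Real.sqrt 3 * W * Q₀ * Q₂) * σ3 ^ 2 * (X ^ pw * X ^ b₀ * X ^ b₂) := by ring
    have e' : (σ3 * Q₁ * X ^ b₁) ^ 2 = Q₁ ^ 2 * σ3 ^ 2 * (X ^ b₁ * X ^ b₁) := by ring
    have hx : X ^ pw * X ^ b₀ * X ^ b₂ ≤ X ^ b₁ * X ^ b₁ := by
      rw [hXadd, hXadd, hXadd]
      exact hXb (by linarith)
    have h2 : (Real.sqrt 3 * W * Q₀ * Q₂) * σ3 ^ 2 * (X ^ pw * X ^ b₀ * X ^ b₂) ≤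
        Q₁ ^ 2 * σ3 ^ 2 * (X ^ b₁ * X ^ b₁) :=
      mul_le_mul (mul_le_mul_of_nonneg_right hI12 (by positivity)) hx (by positivity) (by positivity)
    refine Real.sqrt_le_iff.2 ⟨by positivity, ?_⟩
    rw [e']
    exact h1.trans (e.le.trans h2)
  exact ⟨sE1, sE2⟩

end Summit.AtomisticToContinuum.HydrodynamicLimit.Theorems

end
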